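import Summits.ValiantsHypothesis.ValiantsHypothesis.Theorems.GeneratorObstructionsPerGenDegreeSuperQPAtomCertificates
import Mathlib.LinearAlgebra.TensorProduct.Submodule

/-!
# Route GeneratorObstructions — K1 `PerGenDegreeSuperQP` (stmt-ValiantsHypothesis-11654):
# the DIMENSION-GAP certificate for generator counts `γ_χ`

Sixth support file toward K1 (line `per-side-atoms` and its foreseen fallback). The route's
generator count is `γ_χ(f) = dim (HWV_χ ⧸ HWV_χ ∩ Σ_{χ₁+χ₂=χ, χᵢ≠0} HWV_χ₁ · HWV_χ₂)` (the number of
minimal generators of type `χ` of the covariant algebra `A(Δ_n[f]) = ⊕_χ HWV_χ(ℂ[Δ_n[f]])`). The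
landed `stub_atomGen` is the extreme case "no splitting occurs"; the line card names, as the
fallback if late ATOMS do not exist, the **dimension-gap form**: `γ_χ > 0` as soon as ONE
multiplicity `mult_χ = dim HWV_χ` exceeds the room offered by all splittings. This file makes that
certificate kernel-checkable, for ANY polynomial `f` (linearly ordered finite variables, `n ≠ 0`):

* `finrank_mul_le` — `dim (M·N) ≤ dim M · dim N` (multiplication `M ⊗ N ↠ M·N`, Mathlib
  `Submodule.mulMap_range`); `finrank_biSup_le_sum` — `dim ⨆_{T} ≤ Σ_{T} dim`;
* `finrank_hwv_le_gamma_add_sum` — **`mult_χ ≤ γ_χ + Σ_{(χ₁,χ₂) ∈ T} mult_χ₁ · mult_χ₂`** for every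
  finite set `T` of pairs containing all splittings of `χ` into two nonzero OCCURRING weights
  (rank–nullity on `HWV_χ`; the decomposable part lies in the finite sum of products);
* `gamma_ne_zero_of_sum_lt`, `per_gamma_ne_zero_of_sum_lt` — hence `Σ_T mult·mult < mult_χ` forces
  `γ_χ ≠ 0`, stated for `per_m` in the exact vocabulary of the route decl `PerGenDegreeSuperQP`.

Use: a K1 witness at `(c, m)` is any weight `χ` of degree `-|χ|/m > 2^((log₂ m + c)^c)` with a
multiplicity LOWER bound for `ℂ[Δ_m[per_m]]` at `χ` beating the sum of products of multiplicity
UPPER bounds (e.g. the tree's stabiliser ceilings `orbitMultiplicity_per_le_perOrbitCeiling`,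
BLMW 2011 (5.5.3)) over its splittings. No such witness is known; K1, `stub_atomLate` and
`GenFlipThesis` remain OPEN; nothing here bears on VP versus VNP.
References: [BurgisserEtAl2011] §5.5, §6.1 (semigroup property, stabiliser bounds);
[DerksenMakam2020] Lemma 1.3 (generators under surjections).
-/

set_option linter.dupNamespace false

noncomputable section

namespace Summit.ValiantsHypothesis.ValiantsHypothesis.Theorems.GeneratorObstructions.PerGenDegreeSuperQP

open MvPolynomial
open Literature.NumberTheory.DiophantineGeometry Literature.Computability.AlgebraicComplexity
  Literature.Computability.Complexity

/-! ### 1. Linear algebra: dimensions of products and of finite suprema of submodules -/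

section LinearAlgebra

variable {K A : Type*} [Field K] [CommRing A] [Algebra K A]

/-- `dim (M · N) ≤ dim M · dim N` for finite-dimensional submodules of an algebra: `M · N` is the
image of `M ⊗ N` under multiplication (`Submodule.mulMap_range`). [folklore] -/
theorem finrank_mul_le (M N : Submodule K A) [FiniteDimensional K M] [FiniteDimensional K N] :
    Module.finrank K ↥(M * N) ≤ Module.finrank K M * Module.finrank K N := by
  rw [← Submodule.mulMap_range, ← Module.finrank_tensorProduct]
  exact LinearMap.finrank_range_le _

/-- `M · N` is finite-dimensional for finite-dimensional `M, N`. [folklore] -/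
theorem finiteDimensional_mul (M N : Submodule K A) [FiniteDimensional K M] [FiniteDimensional K N] :
    FiniteDimensional K ↥(M * N) := by
  rw [← Submodule.mulMap_range]
  exact Module.Finite.range _

omit [Algebra K A] in
/-- `dim (⨆_{i ∈ T} M i) ≤ Σ_{i ∈ T} dim (M i)` for a finite family of finite-dimensional
submodules. [folklore] -/
theorem finrank_biSup_le_sum {V : Type*} [AddCommGroup V] [Module K V] {ι : Type*} (T : Finset ι)
    (M : ι → Submodule K V) [∀ i, FiniteDimensional K (M i)] :
    Module.finrank K ↥(⨆ i ∈ T, M i) ≤ ∑ i ∈ T, Module.finrank K (M i) := by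
  classical
  induction T using Finset.induction_on with
  | empty =>
    have h : (⨆ i ∈ (∅ : Finset ι), M i) = ⊥ := by simp
    rw [h, finrank_bot, Finset.sum_empty]
  | insert a s ha ih =>
    rw [Finset.iSup_insert, Finset.sum_insert ha]
    haveI : FiniteDimensional K ↥(⨆ i ∈ s, M i) := by
      rw [← Finset.sup_eq_iSup]; infer_instance
    exact (Submodule.finrank_add_le_finrank_add_finrank _ _).trans (by omega)

end LinearAlgebra

/-! ### 2. The dimension-gap certificate for generator counts -/

section Certificate

variable {σ : Type*} [Fintype σ] [LinearOrder σ]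

/-- **Dimension-gap certificate for `γ_χ`.** Let `f` be any polynomial over `ℂ` in linearly
ordered variables, `n ≠ 0`, `χ` a weight, and `T` a finite set of pairs of weights containing
every splitting `χ = χ₁ + χ₂` into two NONZERO weights that BOTH occur in `ℂ[Δ_n[f]]`. Then
`dim HWV_χ ≤ γ_χ + Σ_{(χ₁,χ₂) ∈ T} dim HWV_χ₁ · dim HWV_χ₂`, where
`γ_χ = dim (HWV_χ ⧸ HWV_χ ∩ Σ_{χ₁+χ₂=χ, χᵢ≠0} HWV_χ₁·HWV_χ₂)` is the generator count of the route's
K1 (`PerGenDegreeSuperQP`): the decomposable part is contained in the finite sum over `T` of the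
products, each of dimension at most the product of the dimensions. The case `T = ∅` is the landed
`stub_atomGen` (atoms are generator types); in general this is the DIMENSION-GAP form of K1 foreseen
by the line's card ("a lower bound on ONE multiplicity of the closure at a late weight versus
… upper bounds on all its splittings"). [folklore] -/
theorem finrank_hwv_le_gamma_add_sum (f : MvPolynomial σ ℂ) {n : ℕ} (hn : n ≠ 0) (χ : Weight σ)
    (T : Finset (Weight σ × Weight σ))
    (hT : ∀ p : Weight σ × Weight σ, p.1 + p.2 = χ → p.1 ≠ 0 → p.2 ≠ 0 →
      highestWeightSpace (orbitCoordRep f n) p.1 ≠ ⊥ →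
      highestWeightSpace (orbitCoordRep f n) p.2 ≠ ⊥ → p ∈ T) :
    Module.finrank ℂ ↥(highestWeightSpace (orbitCoordRep f n) χ) ≤
      Module.finrank ℂ (↥(highestWeightSpace (orbitCoordRep f n) χ) ⧸
        Submodule.comap (highestWeightSpace (orbitCoordRep f n) χ).subtype
          (⨆ p : Weight σ × Weight σ, ⨆ (_ : p.1 + p.2 = χ ∧ p.1 ≠ 0 ∧ p.2 ≠ 0),
            highestWeightSpace (orbitCoordRep f n) p.1 * highestWeightSpace (orbitCoordRep f n) p.2)) +
      ∑ p ∈ T, Module.finrank ℂ ↥(highestWeightSpace (orbitCoordRep f n) p.1) *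
        Module.finrank ℂ ↥(highestWeightSpace (orbitCoordRep f n) p.2) := by
  classical
  haveI : Infinite ℂ := CharZero.infinite ℂ
  haveI hfd : ∀ ψ : Weight σ, FiniteDimensional ℂ ↥(highestWeightSpace (orbitCoordRep f n) ψ) :=
    fun ψ => finiteDimensional_highestWeightSpace_orbitCoordRep_holds f hn ψ
  set H : Weight σ → Submodule ℂ (OrbitCoordRing f n) := fun ψ => highestWeightSpace (orbitCoordRep f n) ψ
    with hH
  set D : Submodule ℂ (OrbitCoordRing f n) :=
    ⨆ p : Weight σ × Weight σ, ⨆ (_ : p.1 + p.2 = χ ∧ p.1 ≠ 0 ∧ p.2 ≠ 0), H p.1 * H p.2 with hD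
  set DT : Submodule ℂ (OrbitCoordRing f n) := ⨆ p ∈ T, H p.1 * H p.2 with hDT
  -- the decomposable part is inside the finite sum over `T`
  have hle : D ≤ DT := by
    refine iSup_le fun p => iSup_le fun hp => ?_
    by_cases h1 : H p.1 = ⊥
    · rw [h1, Submodule.bot_mul]; exact bot_le
    by_cases h2 : H p.2 = ⊥
    · rw [h2, Submodule.mul_bot]; exact bot_le
    have hpT : p ∈ T := hT p hp.1 hp.2.1 hp.2.2 h1 h2
    exact le_iSup₂_of_le p hpT le_rfl
  haveI hprod : ∀ p : Weight σ × Weight σ, FiniteDimensional ℂ ↥(H p.1 * H p.2) :=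
    fun p => finiteDimensional_mul _ _
  haveI : FiniteDimensional ℂ ↥DT := by
    rw [hDT, ← Finset.sup_eq_iSup]; infer_instance
  -- rank–nullity on `HWV_χ`
  set C := Submodule.comap (H χ).subtype D with hC
  have hrn := Submodule.finrank_quotient_add_finrank C
  -- `dim C ≤ dim DT ≤ Σ dim (H p.1 · H p.2) ≤ Σ dim H p.1 · dim H p.2`
  have hC_le : Module.finrank ℂ ↥C ≤ Module.finrank ℂ ↥DT := by
    have hmap : C.map (H χ).subtype ≤ DT :=
      (Submodule.map_comap_le _ _).trans hle
    calc Module.finrank ℂ ↥C = Module.finrank ℂ ↥(C.map (H χ).subtype) :=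
          (LinearEquiv.finrank_eq (Submodule.equivMapOfInjective _ (Submodule.injective_subtype _) C)).symm
            |>.symm
      _ ≤ Module.finrank ℂ ↥DT := Submodule.finrank_mono hmap
  have hDT_le : Module.finrank ℂ ↥DT ≤
      ∑ p ∈ T, Module.finrank ℂ ↥(H p.1) * Module.finrank ℂ ↥(H p.2) :=
    (finrank_biSup_le_sum T fun p => H p.1 * H p.2).trans
      (Finset.sum_le_sum fun p _ => finrank_mul_le _ _)
  have hsum_eq : (∑ p ∈ T, Module.finrank ℂ ↥(H p.1) * Module.finrank ℂ ↥(H p.2)) =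
      ∑ p ∈ T, Module.finrank ℂ ↥(highestWeightSpace (orbitCoordRep f n) p.1) *
        Module.finrank ℂ ↥(highestWeightSpace (orbitCoordRep f n) p.2) := rfl
  rw [hsum_eq] at hDT_le
  change Module.finrank ℂ ↥(H χ) ≤ Module.finrank ℂ (↥(H χ) ⧸ C) + _
  omega

/-- **Hence `γ_χ ≠ 0` whenever `dim HWV_χ` exceeds the splitting count** `Σ_{T} dim·dim` — the
dimension-gap criterion for a generator of type `χ` (`T` as above). [folklore] -/
theorem gamma_ne_zero_of_sum_lt (f : MvPolynomial σ ℂ) {n : ℕ} (hn : n ≠ 0) (χ : Weight σ)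
    (T : Finset (Weight σ × Weight σ))
    (hT : ∀ p : Weight σ × Weight σ, p.1 + p.2 = χ → p.1 ≠ 0 → p.2 ≠ 0 →
      highestWeightSpace (orbitCoordRep f n) p.1 ≠ ⊥ →
      highestWeightSpace (orbitCoordRep f n) p.2 ≠ ⊥ → p ∈ T)
    (hlt : ∑ p ∈ T, Module.finrank ℂ ↥(highestWeightSpace (orbitCoordRep f n) p.1) *
        Module.finrank ℂ ↥(highestWeightSpace (orbitCoordRep f n) p.2) <
      Module.finrank ℂ ↥(highestWeightSpace (orbitCoordRep f n) χ)) :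
    Module.finrank ℂ (↥(highestWeightSpace (orbitCoordRep f n) χ) ⧸
        Submodule.comap (highestWeightSpace (orbitCoordRep f n) χ).subtype
          (⨆ p : Weight σ × Weight σ, ⨆ (_ : p.1 + p.2 = χ ∧ p.1 ≠ 0 ∧ p.2 ≠ 0),
            highestWeightSpace (orbitCoordRep f n) p.1 * highestWeightSpace (orbitCoordRep f n) p.2)) ≠ 0 := by
  have h := finrank_hwv_le_gamma_add_sum f hn χ T hT
  omega

end Certificate

/-! ### 3. The permanent: the dimension-gap form of K1's generator clause -/

section Permanent

variable {m : ℕ}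

/-- **Dimension-gap certificate for `γ_χ(per_m) ≠ 0`** in the exact vocabulary of the route decl
`PerGenDegreeSuperQP` (K1): for `1 ≤ m`, a weight `χ` and a finite set `T` of pairs containing all
splittings of `χ` into two nonzero weights occurring in `ℂ[Δ_m[per_m]]`, the inequality
`Σ_{T} mult_χ₁(per_m) · mult_χ₂(per_m) < mult_χ(per_m)` forces `γ_χ(per_m) ≠ 0`. A K1 witness at
`(c, m)` is therefore any `χ` of degree `-|χ|/m > 2^((log₂ m + c)^c)` passing this test — the line
card's fallback ("dimension-gap form") made kernel-checkable. [folklore] -/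
theorem per_gamma_ne_zero_of_sum_lt (hm : 1 ≤ m) (χ : Weight (MatIdx m))
    (T : Finset (Weight (MatIdx m) × Weight (MatIdx m)))
    (hT : ∀ p : Weight (MatIdx m) × Weight (MatIdx m), p.1 + p.2 = χ → p.1 ≠ 0 → p.2 ≠ 0 →
      highestWeightSpace (orbitCoordRep (MvPolynomial.rename toLex (perPoly (Fin m) ℂ)) m) p.1 ≠ ⊥ →
      highestWeightSpace (orbitCoordRep (MvPolynomial.rename toLex (perPoly (Fin m) ℂ)) m) p.2 ≠ ⊥ →
      p ∈ T)
    (hlt : ∑ p ∈ T,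
        Module.finrank ℂ ↥(highestWeightSpace (orbitCoordRep (MvPolynomial.rename toLex (perPoly (Fin m) ℂ)) m) p.1) *
        Module.finrank ℂ ↥(highestWeightSpace (orbitCoordRep (MvPolynomial.rename toLex (perPoly (Fin m) ℂ)) m) p.2) <
      Module.finrank ℂ ↥(highestWeightSpace (orbitCoordRep (MvPolynomial.rename toLex (perPoly (Fin m) ℂ)) m) χ)) :
    Module.finrank ℂ (↥(highestWeightSpace (orbitCoordRep (MvPolynomial.rename toLex (perPoly (Fin m) ℂ)) m) χ) ⧸ Submodule.comap (highestWeightSpace (orbitCoordRep (MvPolynomial.rename toLex (perPoly (Fin m) ℂ)) m) χ).subtype (⨆ p : Weight (MatIdx m) × Weight (MatIdx m), ⨆ (_ : p.1 + p.2 = χ ∧ p.1 ≠ 0 ∧ p.2 ≠ 0), highestWeightSpace (orbitCoordRep (MvPolynomial.rename toLex (perPoly (Fin m) ℂ)) m) p.1 * highestWeightSpace (orbitCoordRep (MvPolynomial.rename toLex (perPoly (Fin m) ℂ)) m) p.2)) ≠ 0 :=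
  gamma_ne_zero_of_sum_lt _ (by omega) χ T hT hlt

end Permanent

end Summit.ValiantsHypothesis.ValiantsHypothesis.Theorems.GeneratorObstructions.PerGenDegreeSuperQP

end
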